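import Literature.NumberTheory.LFunctions.VinogradovZetaSumBound
import Literature.NumberTheory.LFunctions.VinogradovMeanValueTheorem
import HarnessLib

/-!
# Korobov's bound for the bilinear Weyl sum `∑_{x,y ≤ a} e(∑ α_j x^j y^j)` with an arbitrary set of good indices

Topic `Literature/NumberTheory/LFunctions`.  Everything in this file is PROVED; no definitions, no named facts.
This is the bookkeeping half of the proof of Theorem 6.2 of A. Ivić, *The Riemann Zeta-Function* (Wiley 1985), §6.3,
pp. 121–124 — in the tree as `VinogradovZetaSum.U_bound_of_instance` for the specific coefficients
`α_m(n) = (−1)^m t/(2πm(n+u)^m)` of the zeta sums — isolated from the coefficients: for ARBITRARY real `α₁, …, α_r`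
(`r ≥ 2`), integers `a ≥ 1`, `ρ ≥ 1`, `k ≥ r² + rρ`, a set `good` of indices and a number `S₁` such that for every
`i ∈ good` the `i`-th factor `G_i = ∑_{|μ| ≤ ka^{i+1}} min(2ka^{i+1} + 1, 1/(2‖α_i μ‖))` satisfies the saving
`log G_i ≤ 2 log(2ka^{i+1} + 1) − S₁`, we prove (`norm_U_le_of_good`)

  `|U| ≤ a² · exp(−(|good|·S₁ − T)/(4k²))`,  `T = 2hδ log a + 6kρ log(32r) + 2r log(3k)`,
  `h = ½(r²+r)`, `δ = (1 − 1/r)^ρ`,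

from the core bound `|U|^{4k²} ≤ a^{8k²−4k} J_{k,r}(a)² ∏ G_i` (`VinogradovZetaSum.core_bound`), Vinogradov's mean value
theorem in the unconditional sharp form `J_{k,r}(a) ≤ K63s(r,k)^ρ a^{2k − h + hδ}`, `K63s(r,k) ≤ (32r)^{3k}`
(`VMV.lemma63_sharp`, `VMV.K63s_le` — so NO largeness condition on `a` is needed), and the trivial bound
`G_i ≤ (2ka^{i+1}+1)²` elsewhere.  The consumer is the `ℚ(i)`-analogue of Theorem 6.2 along the lines of the
lattice `ℤ[i]` (`GaussianLineSumVinogradov.lean`), where only every other index can be guaranteed to be good.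

## References

* A. Ivić, *The Riemann Zeta-Function*, John Wiley & Sons 1985 (Dover 2003), §6.3, proof of Theorem 6.2,
  (6.41)–(6.46). [cite: Ivic1985, Theorem 6.2 (proof)]
* N. M. Korobov, *Exponential Sums and their Applications*, Kluwer 1992, Ch. II. [cite: Korobov1992, Ch. II]
-/

noncomputable section

open Finset Real

namespace Literature.NumberTheory.LFunctions

namespace KorobovU

open VdC (e)
open Sieve.Vinogradov (geomBound geomBound_nonneg geomBound_le)
open VinogradovZetaSum VMV

set_option maxHeartbeats 4000000 in
/-- **Korobov's bound with a prescribed set of good indices.**  Let `r ≥ 2`, `a ≥ 1`, `ρ ≥ 1`, `k ≥ r² + rρ`,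
`α : Fin r → ℝ`, and suppose that for every `i ∈ good`
`log G_i ≤ 2 log(2ka^{i+1} + 1) − S₁`, `G_i = ∑_{|μ| ≤ ka^{i+1}} geomBound(2ka^{i+1}+1)(α_i μ)`.  Then
`‖∑_{x ≤ a}∑_{y ≤ a} e(∑_i α_i x^{i+1}y^{i+1})‖ ≤ a² exp(−(|good| S₁ − T)/(4k²))` with
`T = 2hδ log a + 6kρ log(32r) + 2r log(3k)`, `h = ½(r² + r)`, `δ = (1 − 1/r)^ρ`.
[cite: Ivic1985, Theorem 6.2 (proof), (6.41)–(6.46)] -/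
theorem norm_U_le_of_good {r : ℕ} (α : Fin r → ℝ) {a ρ k : ℕ} (hr : 2 ≤ r) (ha : 1 ≤ a) (hρ : 1 ≤ ρ)
    (hk : r ^ 2 + r * ρ ≤ k) (good : Finset (Fin r)) {S₁ : ℝ}
    (hgood : ∀ i ∈ good,
      Real.log (∑ μ ∈ Icc (-((k : ℤ) * (a : ℤ) ^ (i.val + 1))) ((k : ℤ) * (a : ℤ) ^ (i.val + 1)),
        geomBound (2 * k * (a : ℝ) ^ (i.val + 1) + 1) (α i * μ)) ≤
        2 * Real.log (2 * k * (a : ℝ) ^ (i.val + 1) + 1) - S₁) :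
    ‖∑ x ∈ Icc (1 : ℤ) a, ∑ y ∈ Icc (1 : ℤ) a,
        e (∑ j : Fin r, α j * ((x : ℝ) ^ (j.val + 1) * (y : ℝ) ^ (j.val + 1)))‖ ≤
      (a : ℝ) ^ 2 * Real.exp (-((good.card * S₁ -
        (2 * (((r : ℝ) ^ 2 + r) / 2) * (1 - 1 / (r : ℝ)) ^ ρ * Real.log a +
          6 * k * ρ * Real.log (32 * r) + 2 * r * Real.log (3 * k))) / (4 * (k : ℝ) ^ 2))) := by
  -- ### basic facts
  have hr1 : 1 ≤ r := by omega
  have hr0 : (0 : ℝ) < r := by exact_mod_cast (by omega : 0 < r)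
  have hr1' : (1 : ℝ) ≤ r := by exact_mod_cast hr1
  have ha1r : (1 : ℝ) ≤ a := by exact_mod_cast ha
  have ha0 : (0 : ℝ) < a := by linarith
  have hloga0 : 0 ≤ Real.log a := Real.log_nonneg ha1r
  have hk1 : 1 ≤ k := le_trans (by nlinarith) hk
  have hk1' : (1 : ℝ) ≤ k := by exact_mod_cast hk1
  have hk0 : (0 : ℝ) < k := by linarith
  have hkr : r ^ 2 + r ≤ k := le_trans (by nlinarith) hk
  -- ### the core bound
  have hcore := core_bound (r := r) α ha hk1
  set U : ℝ := ‖∑ x ∈ Icc (1 : ℤ) a, ∑ y ∈ Icc (1 : ℤ) a,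
      e (∑ j : Fin r, α j * ((x : ℝ) ^ (j.val + 1) * (y : ℝ) ^ (j.val + 1)))‖ with hUdef
  set Jv : ℝ := (VMV.J r k (Icc (1 : ℤ) a) : ℝ) with hJv
  set G : Fin r → ℝ := fun i => ∑ μ ∈ Icc (-((k : ℤ) * (a : ℤ) ^ (i.val + 1))) ((k : ℤ) * (a : ℤ) ^ (i.val + 1)),
      geomBound (2 * k * (a : ℝ) ^ (i.val + 1) + 1) (α i * μ) with hGdef
  have hcore' : U ^ (4 * k ^ 2) ≤ (a : ℝ) ^ (8 * k ^ 2 - 4 * k) * Jv ^ 2 * ∏ i, G i := hcore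
  have hU0 : 0 ≤ U := norm_nonneg _
  -- ### the goal is trivial when `U = 0`
  rcases hU0.eq_or_lt with hU00 | hUpos
  · rw [← hU00]; positivity
  -- ### positivity of the factors
  have hG0 : ∀ i, 0 ≤ G i := fun i => sum_nonneg fun μ _ => geomBound_nonneg (by positivity) _
  have hJv0 : 0 ≤ Jv := Nat.cast_nonneg _
  have hRHSpos : 0 < (a : ℝ) ^ (8 * k ^ 2 - 4 * k) * Jv ^ 2 * ∏ i, G i :=
    lt_of_lt_of_le (pow_pos hUpos _) hcore'
  have hJvpos : 0 < Jv := by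
    rcases hJv0.eq_or_lt with h | h
    · rw [← h] at hRHSpos; simp at hRHSpos
    · exact h
  have hPpos : 0 < ∏ i, G i := by
    have h1 : 0 < (a : ℝ) ^ (8 * k ^ 2 - 4 * k) * Jv ^ 2 := by positivity
    exact pos_of_mul_pos_right hRHSpos h1.le
  have hGpos : ∀ i, 0 < G i := by
    intro i
    rcases (hG0 i).eq_or_lt with h | h
    · exfalso
      have : ∏ i, G i = 0 := Finset.prod_eq_zero (Finset.mem_univ i) h.symm
      rw [this] at hPpos; exact lt_irrefl _ hPpos
    · exact h
  -- ### taking logarithms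
  have hlogU : (4 * (k : ℝ) ^ 2) * Real.log U ≤
      ((8 * (k : ℝ) ^ 2 - 4 * k)) * Real.log a + 2 * Real.log Jv + ∑ i, Real.log (G i) := by
    have h1 := Real.log_le_log (pow_pos hUpos _) hcore'
    rw [Real.log_pow, Real.log_mul (by positivity) hPpos.ne', Real.log_mul (by positivity) (by positivity),
      Real.log_pow, Real.log_pow, Real.log_prod (fun i _ => (hGpos i).ne')] at h1
    have hcast : ((8 * k ^ 2 - 4 * k : ℕ) : ℝ) = 8 * (k : ℝ) ^ 2 - 4 * k := by
      have : 4 * k ≤ 8 * k ^ 2 := by nlinarith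
      rw [Nat.cast_sub this]; push_cast; ring
    push_cast at h1
    rw [hcast] at h1
    linarith
  -- ### the mean value theorem (sharp form, no largeness condition): `log Jv ≤ 3kρ log(32r) + (2k − h + hδ) log a`
  set δ : ℝ := (1 - 1 / (r : ℝ)) ^ ρ with hδ
  set h : ℝ := ((r : ℝ) ^ 2 + r) / 2 with hh
  have hδ0 : 0 ≤ δ := by
    rw [hδ]; apply pow_nonneg
    rw [sub_nonneg, div_le_one hr0]; exact hr1'
  have hh0 : 0 ≤ h := by rw [hh]; positivity
  have hJ : Jv ≤ K63s r k ^ ρ * (a : ℝ) ^ (2 * (k : ℝ) - ((r : ℝ) ^ 2 + r) / 2 + cr r ρ) :=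
    lemma63_sharp hr ρ hk ha
  have hK : K63s r k ≤ (32 * (r : ℝ)) ^ (3 * k) := K63s_le hr hkr
  have hK1 : 1 ≤ K63s r k := one_le_K63s hr1 k
  have h32r : (1 : ℝ) ≤ 32 * r := by nlinarith
  have hlogJ : Real.log Jv ≤ 3 * k * ρ * Real.log (32 * r) + (2 * k - h + h * δ) * Real.log a := by
    have h1 := Real.log_le_log hJvpos hJ
    rw [Real.log_mul (by positivity) (by positivity), Real.log_pow, Real.log_rpow ha0] at h1
    have h2 : Real.log (K63s r k) ≤ 3 * k * Real.log (32 * r) := by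
      calc Real.log (K63s r k) ≤ Real.log ((32 * (r : ℝ)) ^ (3 * k)) :=
            Real.log_le_log (by linarith) hK
        _ = 3 * k * Real.log (32 * r) := by rw [Real.log_pow]; push_cast; ring
    have h3 : (ρ : ℝ) * Real.log (K63s r k) ≤ ρ * (3 * k * Real.log (32 * r)) :=
      mul_le_mul_of_nonneg_left h2 (Nat.cast_nonneg ρ)
    have hcr : cr r ρ = h * δ := by rw [hh, hδ]; unfold cr; ring
    rw [hcr] at h1
    have h4 : (2 * (k : ℝ) - ((r : ℝ) ^ 2 + r) / 2 + h * δ) = 2 * k - h + h * δ := by rw [hh]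
    rw [h4] at h1
    linarith
  -- ### the `G`-sum: trivial bound everywhere, the good bound on `good`
  have htriv_bound : ∀ i : Fin r, Real.log (G i) ≤ 2 * Real.log (2 * k * (a : ℝ) ^ (i.val + 1) + 1) := fun i =>
    log_sum_geomBound_le k a (i.val + 1) _ (hGpos i)
  have hL_bound : ∀ i : Fin r, 2 * Real.log (2 * k * (a : ℝ) ^ (i.val + 1) + 1) ≤
      2 * Real.log (3 * k) + 2 * ((i.val : ℝ) + 1) * Real.log a := by
    intro i
    have hkam1 : (1 : ℝ) ≤ k * (a : ℝ) ^ (i.val + 1) := one_le_mul_of_one_le_of_one_le hk1' (one_le_pow₀ ha1r)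
    have h1 : 2 * k * (a : ℝ) ^ (i.val + 1) + 1 ≤ 3 * k * (a : ℝ) ^ (i.val + 1) := by linarith
    have h2 : Real.log (2 * k * (a : ℝ) ^ (i.val + 1) + 1) ≤ Real.log (3 * k * (a : ℝ) ^ (i.val + 1)) :=
      Real.log_le_log (by positivity) h1
    rw [Real.log_mul (by positivity) (by positivity), Real.log_pow] at h2
    push_cast at h2
    linarith
  have hsumG : ∑ i, Real.log (G i) ≤ 2 * r * Real.log (3 * k) + 2 * h * Real.log a - S₁ * good.card := by
    classical
    have hsplit : ∑ i, Real.log (G i) = ∑ i ∈ good, Real.log (G i) + ∑ i ∈ univ \ good, Real.log (G i) := by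
      rw [← sum_union disjoint_sdiff, union_sdiff_of_subset (subset_univ _)]
    have hsplit2 : ∑ i : Fin r, (2 * Real.log (3 * k) + 2 * ((i.val : ℝ) + 1) * Real.log a) =
        ∑ i ∈ good, (2 * Real.log (3 * k) + 2 * ((i.val : ℝ) + 1) * Real.log a) +
          ∑ i ∈ univ \ good, (2 * Real.log (3 * k) + 2 * ((i.val : ℝ) + 1) * Real.log a) := by
      rw [← sum_union disjoint_sdiff, union_sdiff_of_subset (subset_univ _)]
    have hgood_sum : ∑ i ∈ good, Real.log (G i) ≤
        ∑ i ∈ good, (2 * Real.log (3 * k) + 2 * ((i.val : ℝ) + 1) * Real.log a) - S₁ * good.card := by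
      calc ∑ i ∈ good, Real.log (G i)
          ≤ ∑ i ∈ good, ((2 * Real.log (3 * k) + 2 * ((i.val : ℝ) + 1) * Real.log a) - S₁) :=
            sum_le_sum fun i hi => (hgood i hi).trans (by linarith [hL_bound i])
        _ = _ := by rw [sum_sub_distrib, sum_const, nsmul_eq_mul]; ring
    have hbad_sum : ∑ i ∈ univ \ good, Real.log (G i) ≤
        ∑ i ∈ univ \ good, (2 * Real.log (3 * k) + 2 * ((i.val : ℝ) + 1) * Real.log a) :=
      sum_le_sum fun i _ => (htriv_bound i).trans (hL_bound i)
    have htotal : ∑ i : Fin r, (2 * Real.log (3 * k) + 2 * ((i.val : ℝ) + 1) * Real.log a) =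
        2 * r * Real.log (3 * k) + 2 * h * Real.log a := by
      rw [sum_add_distrib, sum_const, Finset.card_univ, Fintype.card_fin, nsmul_eq_mul, ← sum_mul, ← mul_sum,
        sum_fin_val_add_one, hh]
      ring
    rw [hsplit]
    linarith
  -- ### conclusion
  set T : ℝ := 2 * h * δ * Real.log a + 6 * k * ρ * Real.log (32 * r) + 2 * r * Real.log (3 * k) with hT
  have hbudget : (4 * (k : ℝ) ^ 2) * (Real.log U - 2 * Real.log a) ≤ -(good.card * S₁ - T) := by
    have hkk : ((8 * (k : ℝ) ^ 2 - 4 * k)) * Real.log a + 2 * ((2 * k - h + h * δ) * Real.log a) +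
        2 * h * Real.log a = 8 * (k : ℝ) ^ 2 * Real.log a + 2 * h * δ * Real.log a := by ring
    rw [hT]
    linarith [hlogU, hlogJ, hsumG, hkk]
  have h4k0 : 0 < 4 * (k : ℝ) ^ 2 := by positivity
  have hfinal : Real.log U - 2 * Real.log a ≤ -((good.card * S₁ - T) / (4 * (k : ℝ) ^ 2)) := by
    rw [← neg_div, le_div_iff₀ h4k0]
    linarith
  have hexp := Real.exp_le_exp.2 hfinal
  rw [Real.exp_sub, Real.exp_log hUpos, show (2 : ℝ) * Real.log a = Real.log a * 2 by ring, Real.exp_mul,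
    Real.exp_log ha0, div_le_iff₀ (by positivity)] at hexp
  calc U ≤ Real.exp (-((good.card * S₁ - T) / (4 * (k : ℝ) ^ 2))) * (a : ℝ) ^ (2 : ℝ) := hexp
    _ = (a : ℝ) ^ 2 * Real.exp (-((good.card * S₁ - T) / (4 * (k : ℝ) ^ 2))) := by rw [Real.rpow_two]; ring

end KorobovU

end Literature.NumberTheory.LFunctions
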